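import Literature.AlgebraicGeometry.HodgeTheory.ChernCharacterCoherent
import Literature.AlgebraicGeometry.KTheory.EulerCharShortExact
import HarnessLib

/-!
# `[F] ∈ K₀(X)` and `ch_k(F)` of a coherent sheaf on a smooth projective variety — Hartshorne III Ex. 6.9 (b), hypothesis-free

Layer `Literature/AlgebraicGeometry/{KTheory, HodgeTheory}` (0 named facts, no definitions, no instances, no notation).
Sequel to `KTheory/EulerCharShortExact` (clauses 1–2 of Hartshorne III Ex. 6.9 (b) PROVED on every smooth projective
variety over a field: `IsSmoothProjective.ofCoh_eq`, `IsSmoothProjective.ofCoh_shortExact`) and to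
`HodgeTheory/ChernCharacterCoherent` (§3 there derives resolution independence ∕ additivity ∕ `ch_k(𝓘_Z)` of the Chern
character `chCoh C X F R k = ch_k([F])` from the NAMED FACT `KTheory.Hartshorne1977_eulerChar_resolution_shortExact`).

Here the same consequences are derived WITHOUT the named fact, with `(hY : IsSmoothProjective n Y)` in place of
`(h : Hartshorne1977_eulerChar_resolution_shortExact) (hX : IsRegular X)` «noetherian, integral, separated»:

* §1 (`K₀`-level, any field `k`, namespace `Literature.AlgebraicGeometry.KTheory.IsSmoothProjective`):
  `ofCoh_eq_of_isFiniteLocallyFree` (`[E]` of a vector bundle on ANY resolution is `KZero.of E`),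
  `ofCoh_eq_zero_of_isZero`, `ofCoh_congr`, **`ofCoh_pushforward_unit_eq : [ι_*𝒪_Z] = [𝒪_Y] − [𝓘_Z]`** and
  `ofCoh_idealSheafOf_eq` on ANY resolutions (closed immersion `ι : Z → Y`), `of_eq_ofCoh_add_ofCoh`;
* §2 (over `ℂ`, through the additive extension `chKZero`, namespace `Literature.AlgebraicGeometry.HodgeTheory.IsSmoothProjective`):
  **`chCoh_eq`** (resolution independence of `ch_k(F)`), **`chCoh_shortExact`** (additivity on short exact sequences of
  coherent sheaves), `chCoh_eq_ch` (a vector bundle on ANY resolution), `chCoh_congr`, `chCoh_eq_zero_of_isZero`,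
  **`chCoh_pushforward_unit_eq`** and **`chCoh_idealSheafOf_eq : ch_k(𝓘_Z) = ch_k(𝒪_X) − ch_k(ι_*𝒪_Z)`** on ANY resolutions.

Every proof is the one-line transcription of the corresponding fact-namespace lemma with the fact's application replaced
by the (P-4a) theorems. The named fact itself (whose hypotheses «noetherian, integral, separated, regular» are Kleiman's
resolution property, Hartshorne III Ex. 6.8, not in the tree) is neither restated nor discharged here, and no consumer of it
is touched: this file only ADDS declarations.

## References

* R. Hartshorne, *Algebraic Geometry*, GTM 52 (1977), III Ex. 6.9 (b) (p. 239), II Prop. 5.9. [Hartshorne1977]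
* W. Fulton, *Intersection Theory*, 2nd ed. (1998), §15.1, Example 15.1.5, App. B.8.3 (iii)–(v). [Fulton1998]
* A. Borel, J.-P. Serre, *Le théorème de Riemann–Roch*, Bull. SMF 86 (1958), §4 Lemmes 11–12. [BorelSerre1958]
-/

noncomputable section

universe u

open CategoryTheory CategoryTheory.Limits AlgebraicGeometry

/-! ### §1 `K₀`-level consequences on a smooth projective variety over a field -/

namespace Literature.AlgebraicGeometry.KTheory

open Literature.AlgebraicGeometry.Modules Literature.AlgebraicGeometry.Morphisms Literature.AlgebraicGeometry.Motives
  Literature.AlgebraicGeometry.KTheory.Adapted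

namespace IsSmoothProjective

variable {k : Type u} [Field k] {n : ℕ} {Y : SchemeOver k}

/-- **On ANY strictly perfect resolution, the class of a vector bundle `E` on a smooth projective variety is `KZero.of E`**
(resolution independence `IsSmoothProjective.ofCoh_eq` against the trivial resolution `E[0]`; a finite locally free module is
coherent, `coh_of_isFiniteLocallyFree`). [cite: Hartshorne1977, III Ex. 6.9 (b) (p. 239)] [cite: Fulton1998, App. B.8.3 (v)] -/
theorem ofCoh_eq_of_isFiniteLocallyFree (hY : IsSmoothProjective n Y) {E : Y.left.Modules} (hE : IsFiniteLocallyFree E)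
    (R : StrictlyPerfectResolution E) : KZero.ofCoh E R = KZero.of E hE := by
  rw [IsSmoothProjective.ofCoh_eq hY (coh_of_isFiniteLocallyFree hE) R (StrictlyPerfectResolution.ofFiniteLocallyFree hE),
    KZero.ofCoh_ofFiniteLocallyFree]

/-- The class of a zero module vanishes on every strictly perfect resolution (smooth projective variety).
[cite: Hartshorne1977, III Ex. 6.9 (b) (p. 239)] -/
theorem ofCoh_eq_zero_of_isZero (hY : IsSmoothProjective n Y) {F : Y.left.Modules} (hF : IsZero F)
    (R : StrictlyPerfectResolution F) : KZero.ofCoh F R = 0 := by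
  rw [ofCoh_eq_of_isFiniteLocallyFree hY (KZero.isFiniteLocallyFree_of_isZero hF) R, KZero.of_isZero hF]

/-- Isomorphic coherent sheaves on a smooth projective variety have the same class, on any resolutions.
[cite: Hartshorne1977, III Ex. 6.9 (b) (p. 239)] -/
theorem ofCoh_congr (hY : IsSmoothProjective n Y) {F F' : Y.left.Modules} (e : F ≅ F') (hF' : Coh F')
    (R : StrictlyPerfectResolution F) (R' : StrictlyPerfectResolution F') : KZero.ofCoh F R = KZero.ofCoh F' R' := by
  rw [← KZero.ofCoh_ofIso R e]
  exact IsSmoothProjective.ofCoh_eq hY hF' _ _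

/-- **`[ι_*𝒪_Z] = [𝒪_Y] − [𝓘_Z]` in `K₀(Y)`** for a closed immersion `ι : Z → Y` into a smooth projective variety, on ANY
strictly perfect resolutions of `𝓘_Z` and of `ι_*𝒪_Z` (resolution independence moves the class of `ι_*𝒪_Z` to the cone
resolution, where the identity is `KZero.ofCoh_pushforward_unit_cone`; `h𝒪` is any proof that `𝒪_Y` is finite locally
free, e.g. `Modules.isFiniteLocallyFree_unitModule`). [cite: Hartshorne1977, III Ex. 6.9 (b) (p. 239) with II Prop. 5.9]
[cite: Fulton1998, Example 15.1.5] -/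
theorem ofCoh_pushforward_unit_eq (hY : IsSmoothProjective n Y) {Z : Scheme.{u}} (ι : Z ⟶ Y.left)
    [IsClosedImmersion ι] (h𝒪 : IsFiniteLocallyFree (unitModule Y.left))
    (R : StrictlyPerfectResolution (idealSheafOf ι))
    (R' : StrictlyPerfectResolution ((Scheme.Modules.pushforward ι).obj (unitModule Z))) :
    KZero.ofCoh _ R' = KZero.of (unitModule Y.left) h𝒪 - KZero.ofCoh (idealSheafOf ι) R := by
  haveI : IsProper Y.hom := hY.isProjectiveOver.isProper
  haveI : IsLocallyNoetherian Y.left := LocallyOfFiniteType.isLocallyNoetherian Y.hom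
  rw [← KZero.ofCoh_pushforward_unit_cone ι h𝒪 R]
  exact IsSmoothProjective.ofCoh_eq hY (coh_pushforward_unit ι) R' _

/-- Rearranged: **`[𝓘_Z] = [𝒪_Y] − [ι_*𝒪_Z]`** on any resolutions (smooth projective `Y`).
[cite: Hartshorne1977, III Ex. 6.9 (b) (p. 239) with II Prop. 5.9] -/
theorem ofCoh_idealSheafOf_eq (hY : IsSmoothProjective n Y) {Z : Scheme.{u}} (ι : Z ⟶ Y.left)
    [IsClosedImmersion ι] (h𝒪 : IsFiniteLocallyFree (unitModule Y.left))
    (R : StrictlyPerfectResolution (idealSheafOf ι))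
    (R' : StrictlyPerfectResolution ((Scheme.Modules.pushforward ι).obj (unitModule Z))) :
    KZero.ofCoh (idealSheafOf ι) R = KZero.of (unitModule Y.left) h𝒪 - KZero.ofCoh _ R' := by
  rw [ofCoh_pushforward_unit_eq hY ι h𝒪 R R', sub_sub_cancel]

/-- **Additivity with the class of a vector bundle**: for `0 → F₁ → E → F₃ → 0` short exact on a smooth projective variety
with `E` a vector bundle, `[E] = [F₁] + [F₃]` on any resolutions of `F₁` and of the coherent `F₃`.
[cite: Hartshorne1977, III Ex. 6.9 (b) (p. 239)] [cite: Fulton1998, App. B.8.3 (iii)] -/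
theorem of_eq_ofCoh_add_ofCoh (hY : IsSmoothProjective n Y) {S : ShortComplex Y.left.Modules} (hS : S.ShortExact)
    (hE : IsFiniteLocallyFree S.X₂) (h₃ : Coh S.X₃) (R₁ : StrictlyPerfectResolution S.X₁)
    (R₃ : StrictlyPerfectResolution S.X₃) :
    KZero.of S.X₂ hE = KZero.ofCoh S.X₁ R₁ + KZero.ofCoh S.X₃ R₃ := by
  rw [KZero.of_eq_ofCoh_add_ofCoh_cone hS hE R₁, IsSmoothProjective.ofCoh_eq hY h₃ (R₁.cone hS hE) R₃]

end IsSmoothProjective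

end Literature.AlgebraicGeometry.KTheory

/-! ### §2 The Chern character `ch_k(F)` on a smooth projective complex variety -/

namespace Literature.AlgebraicGeometry.HodgeTheory

open Literature.AlgebraicGeometry.KTheory Literature.AlgebraicGeometry.Modules Literature.AlgebraicGeometry.Morphisms
  Literature.AlgebraicGeometry.Motives

namespace IsSmoothProjective

variable (C : ChernCharacterBetti) {n : ℕ} {X : SchemeOver ℂ}

/-- **Resolution independence of `ch_k(F)`** for `F` coherent on a smooth projective complex variety, hypothesis-free
(`KTheory.IsSmoothProjective.ofCoh_eq`). [cite: Hartshorne1977, III Ex. 6.9 (b) (p. 239)] [cite: Fulton1998, §15.1 (with App. B.8.3 (v))] -/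
theorem chCoh_eq (hX : IsSmoothProjective n X) {F : X.left.Modules} (hF : Coh F) (R R' : StrictlyPerfectResolution F)
    (k : ℕ) : chCoh C X F R k = chCoh C X F R' k := by
  rw [chCoh_def, chCoh_def, KTheory.IsSmoothProjective.ofCoh_eq hX hF R R']

/-- **Additivity of `ch_k` on short exact sequences of coherent sheaves** on a smooth projective complex variety, on any
resolutions, hypothesis-free (`KTheory.IsSmoothProjective.ofCoh_shortExact`; only the coherence of the middle term is used).
[cite: Hartshorne1977, III Ex. 6.9 (b) (p. 239)] [cite: Fulton1998, §15.1 (with App. B.8.3 (iii))] -/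
theorem chCoh_shortExact (hX : IsSmoothProjective n X) {S : ShortComplex X.left.Modules} (hS : S.ShortExact)
    (h₂ : Coh S.X₂) (R₁ : StrictlyPerfectResolution S.X₁) (R₂ : StrictlyPerfectResolution S.X₂)
    (R₃ : StrictlyPerfectResolution S.X₃) (k : ℕ) :
    chCoh C X S.X₂ R₂ k = chCoh C X S.X₁ R₁ k + chCoh C X S.X₃ R₃ k := by
  rw [chCoh_def, chCoh_def, chCoh_def, KTheory.IsSmoothProjective.ofCoh_shortExact hX hS h₂ R₁ R₂ R₃, map_add]

/-- The same in the binder shape of `HodgeTheory.chCoh_shortExact` (coherence witnesses of all three sheaves).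
[cite: Hartshorne1977, III Ex. 6.9 (b) (p. 239)] -/
theorem chCoh_shortExact' (hX : IsSmoothProjective n X) {S : ShortComplex X.left.Modules} (hS : S.ShortExact)
    (_h₁ : Coh S.X₁) (h₂ : Coh S.X₂) (_h₃ : Coh S.X₃) (R₁ : StrictlyPerfectResolution S.X₁)
    (R₂ : StrictlyPerfectResolution S.X₂) (R₃ : StrictlyPerfectResolution S.X₃) (k : ℕ) :
    chCoh C X S.X₂ R₂ k = chCoh C X S.X₁ R₁ k + chCoh C X S.X₃ R₃ k :=
  chCoh_shortExact C hX hS h₂ R₁ R₂ R₃ k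

/-- **On ANY resolution of a vector bundle `E` on a smooth projective complex variety, `ch_k(E)` is `C.ch X E k`.**
[cite: Hartshorne1977, III Ex. 6.9 (b) (p. 239)] [cite: Fulton1998, §15.1] -/
theorem chCoh_eq_ch (hX : IsSmoothProjective n X) {E : X.left.Modules} (hE : IsFiniteLocallyFree E)
    (R : StrictlyPerfectResolution E) (k : ℕ) : chCoh C X E R k = C.ch X E k := by
  rw [chCoh_def, KTheory.IsSmoothProjective.ofCoh_eq_of_isFiniteLocallyFree hX hE R, chKZero_of]

/-- `ch_k` of a zero module vanishes on every resolution (smooth projective complex variety).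
[cite: Hartshorne1977, III Ex. 6.9 (b) (p. 239)] -/
theorem chCoh_eq_zero_of_isZero (hX : IsSmoothProjective n X) {F : X.left.Modules} (hF : IsZero F)
    (R : StrictlyPerfectResolution F) (k : ℕ) : chCoh C X F R k = 0 := by
  rw [chCoh_def, KTheory.IsSmoothProjective.ofCoh_eq_zero_of_isZero hX hF R, map_zero]

/-- Isomorphic coherent sheaves on a smooth projective complex variety have the same `ch_k`, on any resolutions.
[cite: Hartshorne1977, III Ex. 6.9 (b) (p. 239)] -/
theorem chCoh_congr (hX : IsSmoothProjective n X) {F F' : X.left.Modules} (e : F ≅ F') (hF' : Coh F')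
    (R : StrictlyPerfectResolution F) (R' : StrictlyPerfectResolution F') (k : ℕ) :
    chCoh C X F R k = chCoh C X F' R' k := by
  rw [chCoh_def, chCoh_def, KTheory.IsSmoothProjective.ofCoh_congr hX e hF' R R']

/-- **`ch_k(ι_*𝒪_Z) = ch_k(𝒪_X) − ch_k(𝓘_Z)` on ANY resolutions** of `𝓘_Z` and `ι_*𝒪_Z`, for a closed immersion
`ι : Z → X` into a smooth projective complex variety, hypothesis-free. [cite: Hartshorne1977, III Ex. 6.9 (b) (p. 239) with II Prop. 5.9]
[cite: Fulton1998, Example 15.1.5] -/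
theorem chCoh_pushforward_unit_eq (hX : IsSmoothProjective n X) {Z : Scheme.{0}} (ι : Z ⟶ X.left) [IsClosedImmersion ι]
    (R : StrictlyPerfectResolution (idealSheafOf ι))
    (R' : StrictlyPerfectResolution ((Scheme.Modules.pushforward ι).obj (unitModule Z))) (k : ℕ) :
    chCoh C X _ R' k = C.ch X (unitModule X.left) k - chCoh C X (idealSheafOf ι) R k := by
  rw [chCoh_def, chCoh_def, KTheory.IsSmoothProjective.ofCoh_pushforward_unit_eq hX ι isFiniteLocallyFree_unitModule R R',
    map_sub, chKZero_of]

/-- **`ch_k(𝓘_Z) = ch_k(𝒪_X) − ch_k(ι_*𝒪_Z)` on ANY resolutions** (the headline of (K-coh)), for a closed immersion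
`ι : Z → X` into a smooth projective complex variety, hypothesis-free. [cite: Hartshorne1977, III Ex. 6.9 (b) (p. 239) with II Prop. 5.9]
[cite: Fulton1998, Example 15.1.5] -/
theorem chCoh_idealSheafOf_eq (hX : IsSmoothProjective n X) {Z : Scheme.{0}} (ι : Z ⟶ X.left) [IsClosedImmersion ι]
    (R : StrictlyPerfectResolution (idealSheafOf ι))
    (R' : StrictlyPerfectResolution ((Scheme.Modules.pushforward ι).obj (unitModule Z))) (k : ℕ) :
    chCoh C X (idealSheafOf ι) R k = C.ch X (unitModule X.left) k - chCoh C X _ R' k := by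
  rw [chCoh_pushforward_unit_eq C hX ι R R', sub_sub_cancel]

/-- **`ch_k(E) = ch_k(F₁) + ch_k(F₃)`** for `0 → F₁ → E → F₃ → 0` short exact with `E` a vector bundle on a smooth
projective complex variety, on any resolutions of `F₁` and of the coherent `F₃`. [cite: Hartshorne1977, III Ex. 6.9 (b) (p. 239)]
[cite: Fulton1998, §15.1 (with App. B.8.3 (iii))] -/
theorem ch_eq_chCoh_add_chCoh (hX : IsSmoothProjective n X) {S : ShortComplex X.left.Modules} (hS : S.ShortExact)
    (hE : IsFiniteLocallyFree S.X₂) (h₃ : Coh S.X₃) (R₁ : StrictlyPerfectResolution S.X₁)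
    (R₃ : StrictlyPerfectResolution S.X₃) (k : ℕ) :
    C.ch X S.X₂ k = chCoh C X S.X₁ R₁ k + chCoh C X S.X₃ R₃ k := by
  rw [chCoh_def, chCoh_def, ← map_add, ← KTheory.IsSmoothProjective.of_eq_ofCoh_add_ofCoh hX hS hE h₃ R₁ R₃, chKZero_of]

end IsSmoothProjective

end Literature.AlgebraicGeometry.HodgeTheory

end
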